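import Summits.FinalStateConjecture.FinalStateConjecture.Theorems.SwallowTheDatumParametricKerrBurialLine
import Summits.FinalStateConjecture.FinalStateConjecture.Theorems.SwallowTheDatumUniversalWitnessFamilyThroatSettlesToo
import Literature.Geometry.Lorentzian.ModelData
import Literature.Geometry.Lorentzian.InitialDataPullback
import Literature.Geometry.Lorentzian.InitialDataDilation
import Literature.Geometry.Lorentzian.AFEndDilationDecay
import Literature.Geometry.Lorentzian.AFEndTransport
import Literature.Geometry.Lorentzian.ChartSecondFundamentalFormDilation
import HarnessLib

/-!
# Stub `stub_throatDilation` of the line `Sketch` (`throat-settles-too`)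
(crux `SwallowTheDatum.UniversalWitnessFamily`, item stmt-FinalStateConjecture-10051)

The bag-of-gold datum `C` on `ℝ³` is dilated by every factor `l > 0`: `Cfam l := C.dilate l`
(`h'(y) = h(y/l)`, `k'(y) = l⁻¹ k(y/l)`, `InitialDataDilation.lean`). Admissibility, the joint
smoothness in `(l, y)` and the Schwarzschild annulus (now of mass `l μ` on `{l < ‖y‖ < 2l}`)
transfer verbatim from the collar dilation of the sibling line
(`Theorems/SwallowTheDatumParametricKerrBurialCollarDilation.lean`); the located throat shield of
`C` at radius `2` (an open embedding `Φ` of `{R₁ < ‖y‖}`, `R₁ < M/2`, into `{2 < ‖z‖}` with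
co-compact far zones and `Φ^* C = ((1 + M/2‖y‖)⁴ δ, 0)`) becomes the located throat shield of
`C.dilate l` at radius `2l` with parameters `(lM, lR₁)` and chart `Φ_l(z) = l Φ(z/l)` on
`{l R₁ < ‖z‖}`: `dΦ_l = dΦ ∘ (z ↦ z/l)`-wise equal to `dΦ`, so
`(Φ_l^* C_l)_z(v, w) = h_{Φ(z/l)}(dΦ v, dΦ w) = (1 + M/2‖z/l‖)⁴ ⟨v, w⟩ = (1 + lM/2‖z‖)⁴ ⟨v, w⟩`
and `k` picks up `l⁻¹ · 0 = 0`.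
-/

-- the doubled `FinalStateConjecture` path component is the summit/problem naming scheme, not a mistake
set_option linter.dupNamespace false

noncomputable section

-- instance search through the nested operator type `E3 →L[ℝ] E3 →L[ℝ] ℝ` (as in the tree files)
set_option maxSynthPendingDepth 3

namespace Summit.FinalStateConjecture.FinalStateConjecture.Theorems.SwallowTheDatum.UniversalWitnessFamily

open scoped Manifold ContDiff Topology
open Bundle Set Filter Function Metric Literature.Geometry.Lorentzian Literature.Geometry.Manifold
open Summit.FinalStateConjecture.FinalStateConjecture.Theorems.SwallowTheDatum.ParametricKerrBurial
  (SmoothSectionsOn AgreeAt IsExactSchwarzschildBeyond IsSchwarzschildAnnulus)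
open Summit.FinalStateConjecture.FinalStateConjecture.Theorems.SwallowTheDatum.UniversalWitnessFamily.ThroatSettlesToo
  (zero_notMem_exteriorRegion)

/-! ### Scale covariance of the isotropic conformal factor -/

/-- **Scale covariance of the isotropic conformal factor**: `ψ_M(z/l) = ψ_{lM}(z)` for `l > 0`,
i.e. `1 + M/(2‖z/l‖) = 1 + lM/(2‖z‖)`. [folklore] -/
theorem throatDilation_conformalFactor {l : ℝ} (hl : 0 < l) (M : ℝ) (z : E3) :
    Schwarzschild.conformalFactor M (l⁻¹ • z) = Schwarzschild.conformalFactor (l * M) z := by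
  rw [Schwarzschild.conformalFactor_apply, Schwarzschild.conformalFactor_apply, norm_smul,
    Real.norm_of_nonneg (inv_nonneg.2 hl.le)]
  rcases eq_or_ne ‖z‖ 0 with hz | hz
  · simp [hz]
  · congr 1
    field_simp

/-! ### The located throat shield transports under dilation -/

/-- **The located throat shield transports under dilation.** If `C` is throat-shielded away from
radius `2` (an open embedding `Φ : {R₁ < ‖y‖} → ℝ³`, `R₁ < M/2`, ranging in `{2 < ‖z‖}`, with
co-compact far zones and `Φ^* C = Schwarzschild.conformalData M`), then `C.dilate l` is
throat-shielded away from radius `2l`, with parameters `(lM, lR₁)` and the chart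
`Φ_l(z) = l Φ(z/l)` on `{lR₁ < ‖z‖}`. [folklore] -/
theorem throatDilation_shield (C : InitialDataSet (𝓡 3) E3) {l : ℝ} (hl : 0 < l)
    (hsh : ∃ (M R₁ : ℝ) (hM : 0 < M) (hR : 0 < R₁), R₁ < M / 2 ∧
        ∃ (Φ : exteriorRegion R₁ → E3) (hΦ : ContMDiff 𝓘(ℝ, E3) (𝓡 3) (∞ + 1) Φ)
          (hΦ' : ∀ u, Function.Injective (mfderiv 𝓘(ℝ, E3) (𝓡 3) Φ u)),
          (∀ y : exteriorRegion R₁, (2 : ℝ) < ‖Φ y‖) ∧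
          Topology.IsOpenEmbedding Φ ∧
          (∀ R' : ℝ, IsCompact (Φ '' {y : exteriorRegion R₁ | R' < ‖(y : E3)‖})ᶜ) ∧
          C.comap Φ hΦ hΦ' = Schwarzschild.conformalData (M := M) (exteriorRegion R₁) hM.le
            (zero_notMem_exteriorRegion hR)) :
    ∃ (M R₁ : ℝ) (hM : 0 < M) (hR : 0 < R₁), R₁ < M / 2 ∧
      ∃ (Φ : exteriorRegion R₁ → E3) (hΦ : ContMDiff 𝓘(ℝ, E3) (𝓡 3) (∞ + 1) Φ)
        (hΦ' : ∀ u, Function.Injective (mfderiv 𝓘(ℝ, E3) (𝓡 3) Φ u)),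
        (∀ y : exteriorRegion R₁, 2 * l < ‖Φ y‖) ∧
        Topology.IsOpenEmbedding Φ ∧
        (∀ R' : ℝ, IsCompact (Φ '' {y : exteriorRegion R₁ | R' < ‖(y : E3)‖})ᶜ) ∧
        (C.dilate l hl).comap Φ hΦ hΦ' = Schwarzschild.conformalData (M := M) (exteriorRegion R₁)
          hM.le (zero_notMem_exteriorRegion hR) := by
  obtain ⟨M, R₁, hM, hR, hRM, Φ, hΦ, hΦ', hloc, hopen, hfar, hexact⟩ := hsh
  -- the contraction `σ : {l R₁ < ‖z‖} → {R₁ < ‖y‖}`, `z ↦ z/l`, and the chart `Φl z = l Φ(z/l)`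
  set σ : exteriorRegion (l * R₁) → exteriorRegion R₁ := fun z ↦ (AFEnd.scaleExterior l hl R₁).symm z
    with hσdef
  have hσ : ∀ z, ((σ z : exteriorRegion R₁) : E3) = l⁻¹ • (z : E3) := fun z ↦
    AFEnd.coe_scaleExterior_symm l hl R₁ z
  have hσs : ContMDiff 𝓘(ℝ, E3) 𝓘(ℝ, E3) (∞ + 1) σ := (AFEnd.scaleExterior l hl R₁).symm.contMDiff
  set Φl : exteriorRegion (l * R₁) → E3 := fun z ↦ l • Φ (σ z) with hΦldef
  have hΦl : ∀ z, Φl z = l • Φ (σ z) := fun z ↦ rfl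
  have hΦd : ∀ y, MDifferentiableAt 𝓘(ℝ, E3) (𝓡 3) Φ y := fun y ↦
    (hΦ y).mdifferentiableAt (by simp)
  have hdΦ : ∀ (z : exteriorRegion (l * R₁)) (v : E3),
      mfderiv 𝓘(ℝ, E3) (𝓡 3) Φl z v = mfderiv 𝓘(ℝ, E3) (𝓡 3) Φ (σ z) v := fun z v ↦
    OpensChart.mfderiv_dilate_apply' hl hσ hΦl (hΦd _) v
  have hdΦ' : ∀ z : exteriorRegion (l * R₁),
      mfderiv 𝓘(ℝ, E3) (𝓡 3) Φl z = mfderiv 𝓘(ℝ, E3) (𝓡 3) Φ (σ z) := fun z ↦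
    ContinuousLinearMap.ext (hdΦ z)
  have hΦls : ContMDiff 𝓘(ℝ, E3) (𝓡 3) (∞ + 1) Φl :=
    ((l • ContinuousLinearMap.id ℝ E3).contDiff.contMDiff).comp (hΦ.comp hσs)
  have hΦli : ∀ u, Function.Injective (mfderiv 𝓘(ℝ, E3) (𝓡 3) Φl u) := fun u ↦ by
    rw [hdΦ' u]
    exact hΦ' (σ u)
  have hbase : ∀ z, l⁻¹ • Φl z = Φ (σ z) := fun z ↦ by
    rw [hΦl, smul_smul, inv_mul_cancel₀ hl.ne', one_smul]
  refine ⟨l * M, l * R₁, mul_pos hl hM, mul_pos hl hR, ?_, Φl, hΦls, hΦli, fun z ↦ ?_, ?_,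
    fun R' ↦ ?_, ?_⟩
  · -- `l R₁ < l M / 2`
    rw [mul_div_assoc]
    exact mul_lt_mul_of_pos_left hRM hl
  · -- located beyond `2 l`
    rw [hΦl, norm_smul, Real.norm_of_nonneg hl.le, mul_comm]
    exact mul_lt_mul_of_pos_left (hloc _) hl
  · -- open embedding
    exact (Homeomorph.smulOfNeZero l hl.ne').isOpenEmbedding.comp
      (hopen.comp (AFEnd.scaleExterior l hl R₁).symm.toHomeomorph.isOpenEmbedding)
  · -- co-compact far zones: `Φl '' {R' < ‖z‖} = l • (Φ '' {R'/l < ‖y‖})`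
    have hset : Φl '' {z : exteriorRegion (l * R₁) | R' < ‖(z : E3)‖} =
        (Homeomorph.smulOfNeZero l hl.ne') ''
          (Φ '' {y : exteriorRegion R₁ | R' / l < ‖(y : E3)‖}) := by
      ext x
      simp only [Set.mem_image, Set.mem_setOf_eq]
      constructor
      · rintro ⟨z, hz, rfl⟩
        refine ⟨Φ (σ z), ⟨σ z, ?_, rfl⟩, rfl⟩
        rw [hσ, norm_smul, Real.norm_of_nonneg (inv_nonneg.2 hl.le), div_lt_iff₀' hl,
          ← mul_assoc, mul_inv_cancel₀ hl.ne', one_mul]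
        exact hz
      · rintro ⟨_, ⟨y, hy, rfl⟩, rfl⟩
        refine ⟨AFEnd.scaleExterior l hl R₁ y, ?_, ?_⟩
        · show R' < ‖l • (y : E3)‖
          rw [norm_smul, Real.norm_of_nonneg hl.le]
          exact (div_lt_iff₀' hl).1 hy
        · show l • Φ ((AFEnd.scaleExterior l hl R₁).symm (AFEnd.scaleExterior l hl R₁ y)) = l • Φ y
          rw [Diffeomorph.symm_apply_apply]
    rw [hset, ← image_compl_eq (Homeomorph.smulOfNeZero l hl.ne').bijective]
    exact (hfar _).image (Homeomorph.smulOfNeZero l hl.ne').continuous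
  · -- the data identity `Φl^* (C.dilate l) = conformalData (l M)`
    refine InitialDataSet.ext' (fun z v w ↦ ?_) (fun z v w ↦ ?_)
    · have h1 := congrArg
        (fun D' : InitialDataSet 𝓘(ℝ, E3) (exteriorRegion R₁) ↦ D'.h.inner (σ z) v w) hexact
      simp only [InitialDataSet.comap_h_inner, Schwarzschild.conformalData_h_inner,
        Schwarzschild.conformalInner_apply] at h1 ⊢
      rw [hdΦ, hdΦ, C.dilate_h_inner l hl, hbase, h1, hσ, throatDilation_conformalFactor hl]
    · have h1 := congrArg
        (fun D' : InitialDataSet 𝓘(ℝ, E3) (exteriorRegion R₁) ↦ D'.k (σ z) v w) hexact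
      simp only [InitialDataSet.comap_k, Schwarzschild.conformalData_k] at h1 ⊢
      rw [hdΦ, hdΦ, C.dilate_k l hl, hbase, h1]
      simp

/-! ### The stub -/

/-- **Stub `stub_throatDilation`** (line `Sketch`, `throat-settles-too`): the bag-of-gold datum
dilated by every `l > 0` — `Cfam l = C.dilate l`, `h'(y) = h(y/l)`, `k'(y) = l⁻¹ k(y/l)` — is a
jointly smooth family of admissible data, exactly Schwarzschild(`l μ`) with `k = 0` on
`{l < ‖y‖ < 2l}`, and throat-shielded away from radius `2l` (parameters `(lM, lR₁)`, chart
`l Φ(·/l)`). [folklore] -/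
theorem stub_throatDilation :
    ∀ (C : InitialDataSet (𝓡 3) E3) (μ : ℝ), 0 < μ → C ∈ admissibleVacuumData E3 → IsSchwarzschildAnnulus C μ →
      (∃ (M R₁ : ℝ) (hM : 0 < M) (hR : 0 < R₁), R₁ < M / 2 ∧
        ∃ (Φ : exteriorRegion R₁ → E3) (hΦ : ContMDiff 𝓘(ℝ, E3) (𝓡 3) (∞ + 1) Φ)
          (hΦ' : ∀ u, Function.Injective (mfderiv 𝓘(ℝ, E3) (𝓡 3) Φ u)),
          (∀ y : exteriorRegion R₁, (2 : ℝ) < ‖Φ y‖) ∧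
          Topology.IsOpenEmbedding Φ ∧
          (∀ R' : ℝ, IsCompact (Φ '' {y : exteriorRegion R₁ | R' < ‖(y : E3)‖})ᶜ) ∧
          C.comap Φ hΦ hΦ' = Schwarzschild.conformalData (M := M) (exteriorRegion R₁) hM.le
            (zero_notMem_exteriorRegion hR)) →
      ∃ Cfam : ℝ → InitialDataSet (𝓡 3) E3, SmoothSectionsOn 𝓘(ℝ, ℝ) Cfam {p : ℝ × E3 | 0 < p.1} ∧
        ∀ l : ℝ, 0 < l → Cfam l ∈ admissibleVacuumData E3 ∧
          (∀ y : E3, l < ‖y‖ → ‖y‖ < 2 * l → (Cfam l).h.inner y =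
              (1 + l * μ / (2 * ‖y‖)) ^ 4 • (innerSL ℝ : E3 →L[ℝ] E3 →L[ℝ] ℝ) ∧ (Cfam l).k y = 0) ∧
          ∃ (M R₁ : ℝ) (hM : 0 < M) (hR : 0 < R₁), R₁ < M / 2 ∧
            ∃ (Φ : exteriorRegion R₁ → E3) (hΦ : ContMDiff 𝓘(ℝ, E3) (𝓡 3) (∞ + 1) Φ)
              (hΦ' : ∀ u, Function.Injective (mfderiv 𝓘(ℝ, E3) (𝓡 3) Φ u)),
              (∀ y : exteriorRegion R₁, 2 * l < ‖Φ y‖) ∧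
              Topology.IsOpenEmbedding Φ ∧
              (∀ R' : ℝ, IsCompact (Φ '' {y : exteriorRegion R₁ | R' < ‖(y : E3)‖})ᶜ) ∧
              (Cfam l).comap Φ hΦ hΦ' = Schwarzschild.conformalData (M := M) (exteriorRegion R₁) hM.le
                (zero_notMem_exteriorRegion hR) := by
  -- adapted from `Theorems/SwallowTheDatumParametricKerrBurialCollarDilation.lean` (`stub_collarDilation`)
  intro C μ _ hC hann hsh
  refine ⟨C.dilateFamily, ⟨fun p hp ↦ (C.contMDiffAt_dilateFamily_h hp).contMDiffWithinAt,
    fun p hp ↦ (C.contMDiffAt_dilateFamily_k hp).contMDiffWithinAt⟩, fun l hl ↦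
    ⟨C.dilateFamily_mem_admissibleVacuumData l hl hC, fun y h1 h2 ↦ ?_, ?_⟩⟩
  · -- the dilated Schwarzschild annulus
    rw [C.dilateFamily_of_pos hl]
    have hny : ‖l⁻¹ • y‖ = l⁻¹ * ‖y‖ := by
      rw [norm_smul, Real.norm_of_nonneg (inv_nonneg.2 hl.le)]
    have hy1 : 1 < ‖l⁻¹ • y‖ := by
      rw [hny, lt_inv_mul_iff₀ hl, mul_one]; exact h1
    have hy2 : ‖l⁻¹ • y‖ < 2 := by
      rw [hny, inv_mul_lt_iff₀ hl, mul_comm]; exact h2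
    obtain ⟨hhy, hky⟩ := hann (l⁻¹ • y) hy1 hy2
    have hcoef : 1 + μ / (2 * ‖l⁻¹ • y‖) = 1 + l * μ / (2 * ‖y‖) := by
      rw [hny]; field_simp
    have hhy' : C.coordH (l⁻¹ • y) =
        (1 + μ / (2 * ‖l⁻¹ • y‖)) ^ 4 • (innerSL ℝ : E3 →L[ℝ] E3 →L[ℝ] ℝ) := hhy
    have hky' : C.coordK (l⁻¹ • y) = 0 := hky
    constructor
    · ext v w
      rw [C.dilate_h_inner l hl]
      change C.coordH (l⁻¹ • y) v w = _
      rw [hhy', hcoef]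
      rfl
    · ext v w
      rw [C.dilate_k l hl]
      change l⁻¹ * C.coordK (l⁻¹ • y) v w = 0
      rw [hky']
      simp
  · -- the dilated shield, located beyond `2 l`
    rw [C.dilateFamily_of_pos hl]
    exact throatDilation_shield C hl hsh

end Summit.FinalStateConjecture.FinalStateConjecture.Theorems.SwallowTheDatum.UniversalWitnessFamily

end
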